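import Literature.MathematicalPhysics.QuantumFieldTheory.Balaban1983to89.B8Prop5LandauDataZd
import Literature.MathematicalPhysics.QuantumFieldTheory.Balaban1983to89.B8Ineq166Univ
import Literature.MathematicalPhysics.QuantumFieldTheory.Balaban1983to89.B8Thm4TruncationLocal

/-!
# `Balaban1983to89.B8Prop5WitnessOfDatum` — [Balaban1985RegularSpaces] p. 89 with Prop. 5 p. 94: PRINT'S DATUM FOR `u₁` ((1.68), (1.73),
# (1.74)) GIVES THE `Λ_j`-WITNESSES THE SECT. D∕E JOIN CONSUMES, at every point of `𝔅_k`

statement-level skeleton of published theorems with citation tags; proofs; nothing here is a claim about the Yang–Mills mass gap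

T. Bałaban, *Spaces of regular gauge field configurations on a lattice and gauge fixing conditions*, Commun. Math. Phys. **99** (1985)
75–102 `[Balaban1985RegularSpaces]` ("B8"; journal page = PDF page + 74), held text `paper:balaban1985-cmp99-regular-spaces-gauge-fixing`,
pp. 88–89 [PDF 14–15] and p. 94 [PDF 20]; [3] = T. Bałaban, *Averaging operations for lattice gauge theories*, Commun. Math. Phys. **98** (1985)
17–51 `[Balaban1985Averaging]`, (166)–(167) p. 44, Proposition 10 p. 50.

## THE PRINTED TEXT

p. 94 [PDF 20]: «**Proposition 5.** There exist positive constants c₂, c₃, depending on d and L only, such that for an arbitrary configuration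
U₁ satisfying (1.69), and for the configuration u₁ determined by U₁ and satisfying (1.68), (1.73), (1.74), if α₀ + α₁ ≦ c₂, then there exists
a configuration u′ = e^{iλ} satisfying the equations (1.107) and the bounds (1.108).»  p. 88 [PDF 14]: «(R₀\overline{u₁}ʲ)(y) = 1 for y ∈ Λ_j,
j ≦ k − 2, and for y ∈ Λ_{k−1} ∪ B(Λ_k)» (1.68).  p. 89 [PDF 15]: «We will use only the properties (1.69), (1.73), (1.74) of the configurations
u₁, U₁ in the future. … (1.73), (1.74) together with the condition R₀\overline{u₁}ʲ = 1 on Λ_j imply that u₁ satisfies (166), (167) [3] on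
Bʲ(Λ_j) ⊂ T_{L^{−j}}, thus if we restrict ourselves to Bʲ(Λ_j), e.g., taking u′ = 1 on (Bʲ(Λ_j))ᶜ, then the assumptions of Proposition 10
are satisfied … (we take Λ_{k−1} ∪ B(Λ_k) as Λ_{k−1})».

## WHY THIS FILE (cell `pub-ymgap`, HUMAN RULING D-0062; R134 seat `pub-ymgap-dag-n05-c` g3, DAG node N05 = [B8]; count-neutral)

The N05 knit of record (`Summits/…/BalabanUVNodesN05SubBKnit`, `pub-ymgap-dag-n05-d` g2) displays `p5e : B8.Prop5Exists B₀′ B₁ lan`; the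
member of record `lan := B8Prop5LandauDataZd.zdLan` (typer `lit-balaban-type-B8`) carries print's datum `(u₁, A)` with the hypothesis
`Hyp169 = (1.33) ∧ (1.69) ∧ (1.68) ∧ (1.73)–(1.74)` (`Cond168`, `Cond7374` = [3] (166)∕(167) on the towers).  The Sect. D∕E JOIN of record
(`B8Prop5JoinSectELocal(RD).hFP_kLevel_of_sectE_local'(_RD)`) reaches `u₁` only through THEOREM 4's inductive transformation («`u₁ = glev_j`
on the towers», from `InAx` + `Restr129`), whereas its analytic cores are already typed in WITNESS form (`pub-ymgap-dag-n04-b`'s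
`B8SectEInLambdaWitness`, `B8SectEKLevelInLambda.exists_Dprime_kLevel_w`, `B8Restr129InversionLocal.*_of_witness`,
`B8SectERemainderCovariance.Cnl_negStar_of_witness`): they ask, at every `j ≤ k` and `y ∈ Λ_j`, for a global `ũ` in the [3]-class
`Λ_j(π^*U₀, α₃)` at scale `L^{−j}` w.r.t. the clamped background, agreeing with `u₁` on the tower `Bʲ(y)` (the binder `hwit`).  n05-d's
LOCATED-NEXT (L1) (INBOX l.14039): the general-datum JOIN needs «`hwit` fed by `Cond7374` (u₁ its own witness)».  THIS FILE types exactly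
p. 89's sentence: PRINT'S DATUM ⇒ `hwit` (with UNITARY witnesses), by `pub-ymgap`-r07's extension device `B7Prop8to10Local.inLambda_ext`
(`extOne`: `u₁` on the tower, `1` outside — print's «taking u′ = 1 on (Bʲ(Λ_j))ᶜ» applied to `u₁`).

## WHAT IS PROVED (kernel, theorems only; axioms `propext`∕`Classical.choice`∕`Quot.sound`)

* §1 tower∕block geometry: `under_of_blockIn_tower` (`Bⁿ(w) ⊂ Bᴷ(y)` ⇒ `w` under `y` at depth `K − n`), `blockIn_tower_of_under` (converse),
  `eq_of_blockIn_tower_self`.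
* §2 `cond166On_mono`, `cond167On_mono`, `cond167On_rescale` (the scale change `b·Lⁿ⁺¹·L^{−m} = (L·b)·Lⁿ⁺¹·L^{−(m+1)}`),
  `uavg_eq_one_of_restr129` ((1.29) ⇒ the [3]-averages are `1` on `Λ_j`).
* §3 the class on ONE tower: `inLambdaOn_tower_of_cond7374` (`1 ≤ j ≤ k − 1`, the displayed range of (1.73)∕(1.74)),
  `inLambdaOn_tower_blk_of_cond7374` (`j = k − 1` on `B(Λ_k)`), `inLambdaOn_site_of_restr129` (`j = 0`: the tower is the site `y` and (1.68)
  gives `u₁(y) = 1`), **`inLambdaOn_top_of_datum`** (`j = k`: the tower `Bᵏ(y) = B^{k−1}(B(y))` is assembled from (1.73)∕(1.74) on the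
  enlarged `Λ_{k−1} ∪ B(Λ_k)` and (1.68) at the top; reading (1.74)'s scale `L^{−(k−1)}` at the class scale `L^{−k}` costs ONE factor `L`:
  the class constant is any `α₃ ≥ max(a, L·b)`), **`inLambdaOn_towers_of_datum`** (all `j ≤ k`, `y ∈ Λ_j`).
* §4 witnesses: `exists_witness_of_inLambdaOn`, `exists_unitary_witness_of_inLambdaOn` (r07's `inLambda_ext` on `extOne`),
  **`hwit_of_datum`**, **`hwit_unitary_of_datum`** — literally the binder `hwit` of `exists_Dprime_kLevel_w` (plus unitarity, for
  `witness_inv_of_unitary`), `restr129_of_datum`.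
* §5 at the member of record: **`hwit_of_hyp169`**, `restr129_of_hyp169` — from `(zdLan L B₁ i).Hyp169 α₀ α₁ (u₁, A)` with print's
  constants `a = 16dB₁(α₀ + α₁)`, `b = 4dB₁(α₀ + α₁)`, class constant `α₃ = 16dLB₁(α₀ + α₁)`.

## HONEST SCOPE

Lattice combinatorics and r07's extension device only; NO estimate of [Balaban1985RegularSpaces] or [3] is proved or asserted here (Prop. 10,
the contraction, Sect. E are the consumers').  The clamped background `π^*U₀` and the extension by `1` are DEVICES of the lineage (as in
`B8SectEInLambdaWitness`), not in print.  `≤` for print's `<` as in r07's predicates.  The factor `L` at the top level is a READING of p. 89's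
«we take Λ_{k−1} ∪ B(Λ_k) as Λ_{k−1}» at the class scale the JOIN uses; print's constants depend on `d, L` anyway.  Count-neutral; N05 NOT
discharged; `T_η ↦ ℤᵈ` carriers; one finite `T⁴` programme at fixed `ε`, Bałaban as printed — nothing continuum ∕ ℝ⁴ ∕ OS ∕ mass-gap ∕ Clay.
No `sorry`, no `axiom`, no `instance`, no `notation`.  Unit `pub-ymgap-dag-n05-c` (g3), 2026-08-26.
-/

noncomputable section

open NormedSpace

namespace Literature.MathematicalPhysics.QuantumFieldTheory.Balaban1983to89.B8Prop5WitnessOfDatum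

open B7Prop1Explicit B7Prop2Explicit B7Eq92Concrete B7Eq84Concrete
open B7Eq167Flat (InLambda)
open B7Prop1Local (InBox clampCfg)
open B7Prop8to10Local (BlockIn Cond166On Cond167On InLambdaOn extOne extOne_of_inBox extOne_mem inLambda_ext)
open B8Ineq130 (tlo thi tlo_zero thi_zero tlo_apply thi_apply tlo_le_thi inBox_of_le)
open B8Ineq132 (Under under_tower)
open B8Eq106Local (under_iff_tower)
open B8Eq131Cubes (flm under_flm)
open B8Eq131Derivation (under_zero_iff under_one_corner under_one_block)
open B8Ineq166Univ (flm_under_of_under)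
open B8Eq119TwistedAxial (Restr129 bgT)
open B8Eq178Averages (Cond168 Cond169 restr129_of_cond168 rbar_bgT_eq_uavg)
open B8Thm4TruncationLocal (mem_blockSites_of_under_one under_one_of_mem_blockSites)
open B8Prop5LandauDataZd (Cond7374 ZdLanIdx zdLan)
open B7Eq78Linearization (Rbar zdBlocking)
open Literature.MathematicalPhysics.QuantumLattice (blockSites)

-- `Site` alone could resolve to the torus sites of `Setup.lean`; re-export the `ℤ^d` sites of `B7Prop1Explicit`.
export B7Prop1Explicit (Site)

variable {d : ℕ}

/-! ## §1 Tower∕block geometry: a block inside a tower box is the block of a site under the root -/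

section Geometry

/-- **`Bⁿ(w) ⊂ Bᴷ(y)` ⇒ `w ∈ B^{K−n}(y)`** (level-`n` blocks inside the tower box `[Lᴷy, Lᴷ(y+𝟙) − 𝟙]` are the blocks of the level-`n` sites
under `y`; (1.6) «Ω_j^{(j)} = ⋃ B^{l−j}(Λ_l)» bookkeeping). [cite: Balaban1985RegularSpaces, (1.6) p.77; Balaban1985Averaging, (1) p.17] -/
theorem under_of_blockIn_tower {L : ℕ} (hL : 1 ≤ L) {K n : ℕ} (hn : n ≤ K) {y w : Site d}
    (h : BlockIn L (tlo L y K) (thi L y K) n w) : Under L (K - n) y w := by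
  have hL0 : (0 : ℤ) < (L : ℤ) := by exact_mod_cast hL
  have hPn : (0 : ℤ) < (L : ℤ) ^ n := pow_pos hL0 n
  have hsplit : (L : ℤ) ^ K = (L : ℤ) ^ n * (L : ℤ) ^ (K - n) := by
    rw [← pow_add, Nat.add_sub_cancel' hn]
  intro i
  obtain ⟨h1, h2⟩ := h.1 i
  rw [tlo_apply, tlo_apply, hsplit] at h1
  rw [tlo_apply, thi_apply, hsplit] at h2
  constructor
  · -- `Lⁿ(L^{K−n} y_i) ≤ Lⁿ w_i`
    have h3 : (L : ℤ) ^ n * ((L : ℤ) ^ (K - n) * y i) ≤ (L : ℤ) ^ n * w i := by linarith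
    exact le_of_mul_le_mul_left h3 hPn
  · -- `Lⁿ w_i < Lⁿ(L^{K−n}(y_i + 1))`
    have h3 : (L : ℤ) ^ n * w i < (L : ℤ) ^ n * ((L : ℤ) ^ (K - n) * (y i + 1)) := by linarith
    have h4 : w i < (L : ℤ) ^ (K - n) * (y i + 1) := lt_of_mul_lt_mul_left h3 hPn.le
    linarith

/-- **`w ∈ Bᵐ(y)` ⇒ `Bⁿ(w) ⊂ B^{m+n}(y)`** (the converse nesting: the fine block of a site under the root lies in the root's deeper block;
`B8Ineq132.under_tower`). [cite: Balaban1985RegularSpaces, (1.6) p.77; Balaban1985Averaging, (1) p.17] -/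
theorem blockIn_tower_of_under {L : ℕ} (hL : 1 ≤ L) {m n : ℕ} {y w : Site d} (h : Under L m y w) :
    BlockIn L (tlo L y (m + n)) (thi L y (m + n)) n w := by
  obtain ⟨h1, h2⟩ := (under_iff_tower L m y w).1 h
  have hwt : tlo L w n ≤ thi L w n := fun i => tlo_le_thi hL (le_refl w) n i
  have hc : ∀ z : Site d, Under L n w z → InBox (tlo L y (m + n)) (thi L y (m + n)) z := fun z hz => by
    obtain ⟨a, b⟩ := under_tower h1 h2 hz
    exact inBox_of_le a b
  exact ⟨hc _ ((under_iff_tower L n w _).2 ⟨le_refl _, hwt⟩), hc _ ((under_iff_tower L n w _).2 ⟨hwt, le_refl _⟩)⟩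

/-- The only level-`K` block inside the tower box `Bᴷ(y)` is `Bᴷ(y)` itself. [cite: Balaban1985RegularSpaces, (1.6) p.77] -/
theorem eq_of_blockIn_tower_self {L : ℕ} (hL : 1 ≤ L) {K : ℕ} {y w : Site d}
    (h : BlockIn L (tlo L y K) (thi L y K) K w) : w = y := by
  have hu := under_of_blockIn_tower hL le_rfl h
  rw [Nat.sub_self] at hu
  exact (under_zero_iff L y w).1 hu

/-- A site of a level-`1` block `B(y)` is one of `QuantumLattice.blockSites L y` and conversely (`B8Thm4TruncationLocal`), recorded in the
`Under` spelling used below. [cite: Balaban1985RegularSpaces, (1.68) p.88 («B(Λ_k)»)] -/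
theorem mem_blockSites_iff_under_one {L : ℕ} (y x : Site d) : x ∈ blockSites L y ↔ Under L 1 y x :=
  ⟨under_one_of_mem_blockSites, mem_blockSites_of_under_one⟩

end Geometry

/-! ## §2 Monotonicity and scale of r07's box-local (166)∕(167); the averages on `Λ_j` under (1.29) -/

section Mono

variable {𝔸 : Type*} [NormedRing 𝔸] [NormedAlgebra ℂ 𝔸] [CompleteSpace 𝔸]
variable {L : ℕ} {lo hi : Site d} {U₀ : Site d → Fin d → 𝔸ˣ} {u : Site d → 𝔸ˣ} {k : ℕ}

/-- (166)-on-the-box is monotone in its constant. [cite: Balaban1985Averaging, (166) p.44] -/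
theorem cond166On_mono {a a' : ℝ} (haa : a ≤ a') (h : Cond166On L lo hi U₀ u k a) : Cond166On L lo hi U₀ u k a' :=
  fun j hj w hw => (h j hj w hw).trans haa

/-- (167)-on-the-box is monotone in its constant (at a non-negative scale `η`). [cite: Balaban1985Averaging, (167) p.44] -/
theorem cond167On_mono {b b' η : ℝ} (hη : 0 ≤ η) (hbb : b ≤ b') (h : Cond167On L lo hi U₀ u k b η) :
    Cond167On L lo hi U₀ u k b' η := fun j hj w r hw =>
  (h j hj w r hw).trans (mul_le_mul_of_nonneg_right (mul_le_mul_of_nonneg_right hbb (by positivity)) hη)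

/-- **The scale change at the top level**: (167)-on-the-box with constant `b` at scale `L^{−m}` IS (167)-on-the-box with constant `L·b` at
scale `L^{−(m+1)}` (`b·Lⁿ⁺¹·L^{−m} = (L·b)·Lⁿ⁺¹·L^{−(m+1)}`) — how (1.74) on the enlarged `Λ_{k−1} ∪ B(Λ_k)` (scale `L^{−(k−1)}`) is read on the
towers of `Λ_k` at the class scale `L^{−k}`. [cite: Balaban1985RegularSpaces, (1.74) p.89, p.89 («we take Λ_{k−1} ∪ B(Λ_k) as Λ_{k−1}»)] -/
theorem cond167On_rescale (hL : 1 ≤ L) {b : ℝ} {m : ℕ} (h : Cond167On L lo hi U₀ u k b (((L : ℝ) ^ m)⁻¹)) :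
    Cond167On L lo hi U₀ u k (L * b) (((L : ℝ) ^ (m + 1))⁻¹) := by
  have hL0 : (0 : ℝ) < L := by exact_mod_cast hL
  intro j hj w r hw
  have e : b * (L : ℝ) ^ (j + 1) * ((L : ℝ) ^ m)⁻¹ = L * b * (L : ℝ) ^ (j + 1) * ((L : ℝ) ^ (m + 1))⁻¹ := by
    rw [pow_succ (L : ℝ) m]
    field_simp
  rw [← e]
  exact h j hj w r hw

/-- **(1.29) ⇒ the [3]-averages `(\overline{R₀u₁})ʲ(y)` are `1` on `Λ_j`** (the bridge `B8Eq178Averages.rbar_bgT_eq_uavg` between the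
`Restr129` averages and `B7Eq84Concrete.uavg`). [cite: Balaban1985RegularSpaces, (1.29) p.81, (1.68) p.88; Balaban1985Averaging, (79)–(80) p.30] -/
theorem uavg_eq_one_of_restr129 {Λ : ℕ → Set (Site d)} {u₁ : Site d → 𝔸ˣ} (h : Restr129 L k Λ U₀ u₁) {j : ℕ} (hj : j ≤ k)
    {y : Site d} (hy : y ∈ Λ j) : uavg L U₀ u₁ j y = 1 := by
  have h1 := h j hj y hy
  rw [rbar_bgT_eq_uavg L U₀ u₁ j] at h1
  exact Units.val_eq_one.1 h1

/-- The third clause of (1.68): the level-`k` averages are `1` on the blocks `B(Λ_{k+1})` (print: level `k − 1` on `B(Λ_k)`), as units.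
[cite: Balaban1985RegularSpaces, (1.68) p.88] -/
theorem uavg_eq_one_of_cond168_blk {Λ : ℕ → Set (Site d)} {u₁ : Site d → 𝔸ˣ} (h : Cond168 L k Λ U₀ u₁) {y : Site d}
    (hy : y ∈ Λ (k + 1)) {x : Site d} (hx : x ∈ blockSites L y) : uavg L U₀ u₁ k x = 1 := by
  have h1 := h.2.2 y hy x hx
  rw [rbar_bgT_eq_uavg L U₀ u₁ k] at h1
  exact Units.val_eq_one.1 h1

end Mono

/-! ## §3 The class `Λ_j(U₀, α₃)` ON ONE TOWER from print's datum -/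

section Towers

variable {𝔸 : Type*} [NormedRing 𝔸] [NormedAlgebra ℂ 𝔸] [CompleteSpace 𝔸]
variable {L : ℕ} {Λ : ℕ → Set (Site d)} {U₀ : Site d → Fin d → 𝔸ˣ} {u₁ : Site d → 𝔸ˣ} {a b α₃ : ℝ}

/-- **The displayed range of (1.73)∕(1.74)**: for `1 ≤ j ≤ k − 1` and `y ∈ Λ_j`, `u₁ ∈ Λ_j(U₀, α₃)` on the tower `Bʲ(y)` at scale `L^{−j}` for
any `α₃ ≥ a, b` (levels written `j + 1 ≤ K`). [cite: Balaban1985RegularSpaces, (1.73)–(1.74) pp.88–89, p.89; Balaban1985Averaging, (166)–(167) p.44] -/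
theorem inLambdaOn_tower_of_cond7374 {K : ℕ} (h : Cond7374 L K Λ U₀ u₁ a b) (ha : a ≤ α₃) (hb : b ≤ α₃) {j : ℕ}
    (hj1 : 1 ≤ j) (hjK : j + 1 ≤ K) {y : Site d} (hy : y ∈ Λ j) :
    InLambdaOn L (tlo L y j) (thi L y j) U₀ u₁ j α₃ (((L : ℝ) ^ j)⁻¹) := by
  obtain ⟨h166, h167⟩ := h j y hj1 (Or.inl ⟨hjK, hy⟩)
  exact ⟨cond166On_mono ha h166, cond167On_mono (by positivity) hb h167⟩

/-- **The enlarged top structure «Λ_{k−1} ∪ B(Λ_k)»**: for `j + 1 = K ≥ 2`, `z ∈ Λ_K` and `y ∈ B(z)`, `u₁ ∈ Λ_j(U₀, α₃)` on `Bʲ(y)` at scale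
`L^{−j}`. [cite: Balaban1985RegularSpaces, (1.73)–(1.74) pp.88–89, p.89 («we take Λ_{k−1} ∪ B(Λ_k) as Λ_{k−1}»)] -/
theorem inLambdaOn_tower_blk_of_cond7374 {K : ℕ} (h : Cond7374 L K Λ U₀ u₁ a b) (ha : a ≤ α₃) (hb : b ≤ α₃) {j : ℕ}
    (hj1 : 1 ≤ j) (hjK : j + 1 = K) {z : Site d} (hz : z ∈ Λ K) {y : Site d} (hy : y ∈ blockSites L z) :
    InLambdaOn L (tlo L y j) (thi L y j) U₀ u₁ j α₃ (((L : ℝ) ^ j)⁻¹) := by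
  obtain ⟨h166, h167⟩ := h j y hj1 (Or.inr ⟨hjK, z, hz, hy⟩)
  exact ⟨cond166On_mono ha h166, cond167On_mono (by positivity) hb h167⟩

/-- **Level `0`**: the tower of `y ∈ Λ₀` is the site `y`, where (1.29)∕(1.68) reads `u₁(y) = 1`; hence `u₁ ∈ Λ₀(U₀, α₃)` on it for every
`α₃ ≥ 0` (the only (166)-expression is `|u₁(y) − 1| = 0`, (167) is void). [cite: Balaban1985RegularSpaces, (1.29) p.81, (1.14) p.78; Balaban1985Averaging, (166) p.44] -/
theorem inLambdaOn_site_of_restr129 (hL : 1 ≤ L) {K : ℕ} (h129 : Restr129 L K Λ U₀ u₁) (hα₃ : 0 ≤ α₃) {η : ℝ} {y : Site d}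
    (hy : y ∈ Λ 0) : InLambdaOn L (tlo L y 0) (thi L y 0) U₀ u₁ 0 α₃ η := by
  refine ⟨fun j hj w hw => ?_, fun j hj => absurd hj (Nat.not_lt_zero j)⟩
  obtain rfl : j = 0 := Nat.le_zero.1 hj
  obtain rfl : w = y := eq_of_blockIn_tower_self hL hw
  rw [uavg_eq_one_of_restr129 h129 (Nat.zero_le K) hy, Units.val_one, sub_self, norm_zero]
  exact hα₃

/-- **The top level `j = k`** (written `k + 1`): for `y ∈ Λ_{k+1}` the tower `B^{k+1}(y)` is the union of the towers `Bᵏ(y′)`, `y′ ∈ B(y) ⊂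
Λ_k ∪ B(Λ_{k+1})`, on which (1.73)∕(1.74) give (166)∕(167) at scale `L^{−k}`; the two top expressions (the level-`(k+1)` average at `y`, the
(167)-expression of the step `k → k + 1`) are identically `1` by (1.68) («R₀\overline{u₁}ᵏ = 1 on B(Λ_{k+1})» and its consequence (1.29) at level
`k + 1`).  Reading scale `L^{−k}` at `L^{−(k+1)}` costs one factor `L`: any `α₃ ≥ max(a, L·b)` is a class constant (`b ≥ 0`, `L ≥ 1`).  The case
`k = 0` (print's `k = 1`, `u₁ = 1` on `B(Λ₁)`) is (1.68) alone. [cite: Balaban1985RegularSpaces, (1.68) p.88, (1.73)–(1.74) pp.88–89, p.89, p.90 (sentence before (1.78)); Balaban1985Averaging, (166)–(167) p.44] -/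
theorem inLambdaOn_top_of_datum (hL : 1 ≤ L) {k : ℕ} (h68 : Cond168 L k Λ U₀ u₁) (h74 : Cond7374 L (k + 1) Λ U₀ u₁ a b)
    (ha : a ≤ α₃) (hb : 0 ≤ b) (hLb : L * b ≤ α₃) {y : Site d} (hy : y ∈ Λ (k + 1)) :
    InLambdaOn L (tlo L y (k + 1)) (thi L y (k + 1)) U₀ u₁ (k + 1) α₃ (((L : ℝ) ^ (k + 1))⁻¹) := by
  have hL0 : (0 : ℝ) ≤ L := Nat.cast_nonneg L
  have hL1 : (1 : ℝ) ≤ L := by exact_mod_cast hL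
  have hbα : b ≤ α₃ := le_trans (by nlinarith [mul_nonneg (sub_nonneg.2 hL1) hb]) hLb
  have hα₃ : 0 ≤ α₃ := le_trans (by positivity) hLb
  have h129 : Restr129 L (k + 1) Λ U₀ u₁ := restr129_of_cond168 hL h68
  -- the top average and the top (167)-expression are identically `1`
  have htop : uavg L U₀ u₁ (k + 1) y = 1 := uavg_eq_one_of_restr129 h129 le_rfl hy
  have hblk : ∀ x : Site d, Under L 1 y x → uavg L U₀ u₁ k x = 1 := fun x hx =>
    uavg_eq_one_of_cond168_blk h68 hy (mem_blockSites_of_under_one hx)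
  -- the level-`k` root under `y` of a block inside the big tower, and (1.73)∕(1.74) on its tower
  have hroot : ∀ {n : ℕ} {w : Site d}, n ≤ k → BlockIn L (tlo L y (k + 1)) (thi L y (k + 1)) n w →
      ∃ y' : Site d, Under L 1 y y' ∧ BlockIn L (tlo L y' k) (thi L y' k) n w := by
    intro n w hn hw
    have hu : Under L (k + 1 - n) y w := under_of_blockIn_tower hL (by omega) hw
    refine ⟨flm L (k - n) w, ?_, ?_⟩
    · have h1 := flm_under_of_under hL (show k - n ≤ k + 1 - n by omega) hu
      rwa [show k + 1 - n - (k - n) = 1 by omega] at h1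
    · have h2 := blockIn_tower_of_under hL (n := n) (under_flm hL (k - n) w)
      rwa [show k - n + n = k by omega] at h2
  rcases Nat.eq_zero_or_pos k with hk | hk
  · -- `k = 0`: `u₁ = 1` on `B(y)` by (1.68); levels `0, 1` only
    subst hk
    refine ⟨fun n hn w hw => ?_, fun n hn w r hw => ?_⟩
    · rcases Nat.lt_or_ge n 1 with hn1 | hn1
      · obtain rfl : n = 0 := by omega
        -- `w` is a site of `B(y)`
        have hu : Under L 1 y w := by simpa using under_of_blockIn_tower hL (by omega) hw
        have h1 : uavg L U₀ u₁ 0 w = 1 := hblk w hu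
        rw [h1, Units.val_one, sub_self, norm_zero]; exact hα₃
      · obtain rfl : n = 1 := by omega
        obtain rfl : w = y := eq_of_blockIn_tower_self hL hw
        rw [htop, Units.val_one, sub_self, norm_zero]; exact hα₃
    · obtain rfl : n = 0 := by omega
      rw [eq_of_blockIn_tower_self hL hw, hblk _ (under_one_corner hL y), hblk _ (under_one_block L y r), inv_one, one_mul,
        map_one, Units.val_one, sub_self, norm_zero]
      positivity
  · -- `k ≥ 1`: (1.73)∕(1.74) on the towers `Bᵏ(y′)`, `y′ ∈ B(y)`
    refine ⟨fun n hn w hw => ?_, fun n hn w r hw => ?_⟩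
    · rcases Nat.lt_or_ge n (k + 1) with hn1 | hn1
      · obtain ⟨y', hy', hw'⟩ := hroot (by omega) hw
        obtain ⟨h166, -⟩ := inLambdaOn_tower_blk_of_cond7374 h74 ha hbα hk rfl hy (mem_blockSites_of_under_one hy')
        exact h166 n (by omega) w hw'
      · obtain rfl : n = k + 1 := by omega
        obtain rfl : w = y := eq_of_blockIn_tower_self hL hw
        rw [htop, Units.val_one, sub_self, norm_zero]; exact hα₃
    · rcases Nat.lt_or_ge n k with hn1 | hn1
      · obtain ⟨y', hy', hw'⟩ := hroot (show n + 1 ≤ k by omega) hw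
        obtain ⟨-, h167⟩ := h74 k y' hk (Or.inr ⟨rfl, y, hy, mem_blockSites_of_under_one hy'⟩)
        have h167' := cond167On_mono (b' := α₃) (by positivity) hLb (cond167On_rescale hL h167)
        exact h167' n hn1 w r hw'
      · obtain rfl : n = k := by omega
        rw [eq_of_blockIn_tower_self hL hw, hblk _ (under_one_corner hL y), hblk _ (under_one_block L y r), inv_one, one_mul,
          map_one, Units.val_one, sub_self, norm_zero]
        positivity

/-- **PRINT'S DATUM ⇒ THE CLASS ON EVERY TOWER OF `𝔅_k`**: under (1.68) (`Cond168 L k`, print's `k` written `k + 1`) and (1.73)∕(1.74)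
(`Cond7374 L (k+1) … a b`, `b ≥ 0`), for every `j ≤ k + 1` and `y ∈ Λ_j`, `u₁ ∈ Λ_j(U₀, α₃)` on `Bʲ(y)` at scale `L^{−j}` with any
`α₃ ≥ max(a, L·b)`. [cite: Balaban1985RegularSpaces, p.89 («(1.73), (1.74) together with the condition R₀ū₁ʲ = 1 on Λ_j imply that u₁ satisfies (166), (167) [3] on Bʲ(Λ_j)»), (1.68) p.88; Balaban1985Averaging, (166)–(167) p.44] -/
theorem inLambdaOn_towers_of_datum (hL : 1 ≤ L) {k : ℕ} (h68 : Cond168 L k Λ U₀ u₁) (h74 : Cond7374 L (k + 1) Λ U₀ u₁ a b)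
    (ha : a ≤ α₃) (hb : 0 ≤ b) (hLb : L * b ≤ α₃) :
    ∀ j, j ≤ k + 1 → ∀ y ∈ Λ j, InLambdaOn L (tlo L y j) (thi L y j) U₀ u₁ j α₃ (((L : ℝ) ^ j)⁻¹) := by
  have hL0 : (1 : ℝ) ≤ L := by exact_mod_cast hL
  have hα₃ : 0 ≤ α₃ := le_trans (by positivity) hLb
  have hb' : b ≤ α₃ := le_trans (by nlinarith [mul_nonneg (sub_nonneg.2 hL0) hb]) hLb
  have h129 : Restr129 L (k + 1) Λ U₀ u₁ := restr129_of_cond168 hL h68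
  intro j hj y hy
  rcases Nat.eq_zero_or_pos j with hj0 | hj0
  · subst hj0
    exact inLambdaOn_site_of_restr129 hL h129 hα₃ hy
  rcases Nat.lt_or_ge j (k + 1) with hj1 | hj1
  · exact inLambdaOn_tower_of_cond7374 h74 ha hb' hj0 (by omega) hy
  · obtain rfl : j = k + 1 := le_antisymm hj hj1
    exact inLambdaOn_top_of_datum hL h68 h74 ha hb hLb hy

end Towers

/-! ## §4 Witnesses: r07's extension by `1` (print: «taking u′ = 1 on (Bʲ(Λ_j))ᶜ») -/

section Witness

variable {𝔸 : Type*} [NormedRing 𝔸] [NormedAlgebra ℂ 𝔸] [CompleteSpace 𝔸]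
variable {L : ℕ} {U₀ : Site d → Fin d → 𝔸ˣ} {u₁ : Site d → 𝔸ˣ}

/-- **A `Λ_j`-WITNESS from the class on the tower**: `ũ := (u₁ on Bʲ(y), 1 outside)` lies in `Λ_j(π^*U₀, α₃)` globally
(`B7Prop8to10Local.inLambda_ext`) and agrees with `u₁` on `Bʲ(y)` — the binder shape of `B8SectEInLambdaWitness` ∕
`B8SectEKLevelInLambda.exists_Dprime_kLevel_w`. [cite: Balaban1985RegularSpaces, p.89 («taking u′ = 1 on (Bʲ(Λ_j))ᶜ»); Balaban1985Averaging, (166)–(167) p.44] -/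
theorem exists_witness_of_inLambdaOn (hL : 1 ≤ L) {j : ℕ} {y : Site d} {α₃ η : ℝ} (hα₃ : 0 ≤ α₃) (hη : 0 ≤ η)
    (h : InLambdaOn L (tlo L y j) (thi L y j) U₀ u₁ j α₃ η) :
    ∃ ut : Site d → 𝔸ˣ, InLambda L (clampCfg (tlo L y j) (thi L y j) U₀) ut j α₃ η ∧
      ∀ x : Site d, tlo L y j ≤ x → x ≤ thi L y j → u₁ x = ut x :=
  ⟨extOne (tlo L y j) (thi L y j) u₁, inLambda_ext hL hα₃ hη h, fun _ hx hx' => (extOne_of_inBox (inBox_of_le hx hx')).symm⟩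

/-- **`hwit` OF THE WITNESS-FORM SECT. E CORES FROM PRINT'S DATUM**: (1.68) ∧ (1.73)–(1.74) ⇒ for every `j ≤ k + 1`, `y ∈ Λ_j` a global `ũ`
with `InLambda L (π^*U₀) ũ j α₃ (Lʲ)⁻¹` agreeing with `u₁` on `Bʲ(y)` (`α₃ ≥ max(a, L·b)`, `b ≥ 0`) — literally the binder `hwit` of
`B8SectEKLevelInLambda.exists_Dprime_kLevel_w` at `k + 1` levels. [cite: Balaban1985RegularSpaces, p.89, Prop. 5 p.94; Balaban1985Averaging, Prop. 10 p.50] -/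
theorem hwit_of_datum (hL : 1 ≤ L) {k : ℕ} {Λ : ℕ → Set (Site d)} {a b α₃ : ℝ} (h68 : Cond168 L k Λ U₀ u₁)
    (h74 : Cond7374 L (k + 1) Λ U₀ u₁ a b) (ha : a ≤ α₃) (hb : 0 ≤ b) (hLb : L * b ≤ α₃) :
    ∀ j, j ≤ k + 1 → ∀ y ∈ Λ j, ∃ ut : Site d → 𝔸ˣ,
      InLambda L (clampCfg (tlo L y j) (thi L y j) U₀) ut j α₃ (((L : ℝ) ^ j)⁻¹) ∧
      ∀ x : Site d, tlo L y j ≤ x → x ≤ thi L y j → u₁ x = ut x := by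
  have hL0 : (0 : ℝ) ≤ L := Nat.cast_nonneg L
  have hα₃ : 0 ≤ α₃ := le_trans (by positivity) hLb
  intro j hj y hy
  exact exists_witness_of_inLambdaOn hL hα₃ (by positivity) (inLambdaOn_towers_of_datum hL h68 h74 ha hb hLb j hj y hy)

/-- (1.68) ⇒ (1.29) at `k + 1` levels (`B8Eq178Averages.restr129_of_cond168`, re-exported next to `hwit_of_datum`: the JOIN's `h129`).
[cite: Balaban1985RegularSpaces, p.90 (sentence before (1.78)), (1.68) p.88, (1.29) p.81] -/
theorem restr129_of_datum (hL : 1 ≤ L) {k : ℕ} {Λ : ℕ → Set (Site d)} (h68 : Cond168 L k Λ U₀ u₁) :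
    Restr129 L (k + 1) Λ U₀ u₁ :=
  restr129_of_cond168 hL h68

end Witness

/-! ## §4b Unitary witnesses (unitary data, print's `G = U(N)`; needed by `witness_inv_of_unitary`) -/

section Unitary

variable {𝔸 : Type*} [CStarAlgebra 𝔸]
variable {L : ℕ} {U₀ : Site d → Fin d → 𝔸ˣ} {u₁ : Site d → 𝔸ˣ}

/-- The extension of a unitary `u₁` by `1` is unitary; so the witness of `exists_witness_of_inLambdaOn` may be taken UNITARY.
[cite: Balaban1985RegularSpaces, p.89, p.95 («u′ = u₂u₁⁻¹ satisfies the regularity conditions»); Balaban1985Averaging, p.23 («values in U(N)»)] -/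
theorem exists_unitary_witness_of_inLambdaOn (hL : 1 ≤ L) (hu₁ : ∀ x, u₁ x ∈ unitaryUnits 𝔸) {j : ℕ} {y : Site d} {α₃ η : ℝ}
    (hα₃ : 0 ≤ α₃) (hη : 0 ≤ η) (h : InLambdaOn L (tlo L y j) (thi L y j) U₀ u₁ j α₃ η) :
    ∃ ut : Site d → 𝔸ˣ, (∀ x, ut x ∈ unitaryUnits 𝔸) ∧ InLambda L (clampCfg (tlo L y j) (thi L y j) U₀) ut j α₃ η ∧
      ∀ x : Site d, tlo L y j ≤ x → x ≤ thi L y j → u₁ x = ut x :=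
  ⟨extOne (tlo L y j) (thi L y j) u₁, fun x => extOne_mem (fun z _ => hu₁ z) x, inLambda_ext hL hα₃ hη h,
    fun _ hx hx' => (extOne_of_inBox (inBox_of_le hx hx')).symm⟩

/-- **`hwit` WITH UNITARY WITNESSES from print's datum** (unitary `u₁`): as `hwit_of_datum`, each `ũ` unitary-valued.
[cite: Balaban1985RegularSpaces, p.89, Prop. 5 p.94; Balaban1985Averaging, Prop. 10 p.50] -/
theorem hwit_unitary_of_datum (hL : 1 ≤ L) (hu₁ : ∀ x, u₁ x ∈ unitaryUnits 𝔸) {k : ℕ} {Λ : ℕ → Set (Site d)} {a b α₃ : ℝ}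
    (h68 : Cond168 L k Λ U₀ u₁) (h74 : Cond7374 L (k + 1) Λ U₀ u₁ a b) (ha : a ≤ α₃) (hb : 0 ≤ b) (hLb : L * b ≤ α₃) :
    ∀ j, j ≤ k + 1 → ∀ y ∈ Λ j, ∃ ut : Site d → 𝔸ˣ, (∀ x, ut x ∈ unitaryUnits 𝔸) ∧
      InLambda L (clampCfg (tlo L y j) (thi L y j) U₀) ut j α₃ (((L : ℝ) ^ j)⁻¹) ∧
      ∀ x : Site d, tlo L y j ≤ x → x ≤ thi L y j → u₁ x = ut x := by
  have hL0 : (0 : ℝ) ≤ L := Nat.cast_nonneg L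
  have hα₃ : 0 ≤ α₃ := le_trans (by positivity) hLb
  intro j hj y hy
  exact exists_unitary_witness_of_inLambdaOn hL hu₁ hα₃ (by positivity) (inLambdaOn_towers_of_datum hL h68 h74 ha hb hLb j hj y hy)

end Unitary

/-! ## §5 At the member of record `zdLan`: the witnesses from `Hyp169` with print's constants -/

section Member

variable {𝔸 : Type} [CStarAlgebra 𝔸]

/-- **(1.29) for the datum of `zdLan`**: `Hyp169 α₀ α₁ (u₁, A)` ⇒ `Restr129 L k Λ U₀ u₁` (its (1.68)-clause, `k ≥ 1`).
[cite: Balaban1985RegularSpaces, (1.68) p.88, p.90 (sentence before (1.78)), (1.29) p.81] -/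
theorem restr129_of_hyp169 {L : ℕ} (hL : 1 ≤ L) (B₁ : ℝ) (i : ZdLanIdx d 𝔸) {α₀ α₁ : ℝ} {p : (zdLan L B₁ i).Cfg}
    (h : (zdLan L B₁ i).Hyp169 α₀ α₁ p) : Restr129 L i.k i.Λ i.U₀ p.1.1 := by
  obtain ⟨-, -, h68, -⟩ := h
  have e : i.k - 1 + 1 = i.k := Nat.sub_add_cancel i.hk
  have h1 := restr129_of_cond168 hL h68
  rwa [e] at h1

/-- **THE JOIN'S `hwit` AT THE MEMBER OF RECORD, print's constants**: from `(zdLan L B₁ i).Hyp169 α₀ α₁ (u₁, A)` ((1.33) ∧ (1.69) ∧ (1.68) ∧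
(1.73)–(1.74) with `a = 16dB₁(α₀ + α₁)`, `b = 4dB₁(α₀ + α₁)`), for every `j ≤ k`, `y ∈ Λ_j` a UNITARY `ũ ∈ Λ_j(π^*U₀, 16dLB₁(α₀ + α₁))` at scale
`L^{−j}` agreeing with `u₁` on `Bʲ(y)` (`B₁ ≥ 0`, `α₀ + α₁ ≥ 0`, `L ≥ 1`). [cite: Balaban1985RegularSpaces, Prop. 5 p.94, (1.68) p.88, (1.73)–(1.74) pp.88–89, p.89; Balaban1985Averaging, (166)–(167) p.44] -/
theorem hwit_of_hyp169 {L : ℕ} (hL : 1 ≤ L) {B₁ : ℝ} (hB₁ : 0 ≤ B₁) (i : ZdLanIdx d 𝔸) {α₀ α₁ : ℝ} (hα : 0 ≤ α₀ + α₁)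
    {p : (zdLan L B₁ i).Cfg} (h : (zdLan L B₁ i).Hyp169 α₀ α₁ p) :
    ∀ j, j ≤ i.k → ∀ y ∈ i.Λ j, ∃ ut : Site d → 𝔸ˣ, (∀ x, ut x ∈ unitaryUnits 𝔸) ∧
      InLambda L (clampCfg (tlo L y j) (thi L y j) i.U₀) ut j (16 * d * L * B₁ * (α₀ + α₁)) (((L : ℝ) ^ j)⁻¹) ∧
      ∀ x : Site d, tlo L y j ≤ x → x ≤ thi L y j → p.1.1 x = ut x := by
  obtain ⟨-, -, h68, h74⟩ := h
  obtain ⟨k, hk⟩ : ∃ k, i.k = k + 1 := ⟨i.k - 1, (Nat.sub_add_cancel i.hk).symm⟩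
  have ek : i.k - 1 = k := by omega
  rw [ek] at h68
  rw [hk] at h74 ⊢
  have hL1 : (1 : ℝ) ≤ L := by exact_mod_cast hL
  have hd : (0 : ℝ) ≤ d := Nat.cast_nonneg d
  have hs : 0 ≤ (d : ℝ) * B₁ * (α₀ + α₁) := by positivity
  have ha : 16 * (d : ℝ) * B₁ * (α₀ + α₁) ≤ 16 * d * L * B₁ * (α₀ + α₁) := by nlinarith
  have hb : (0 : ℝ) ≤ 4 * d * B₁ * (α₀ + α₁) := by positivity
  have hLb : (L : ℝ) * (4 * d * B₁ * (α₀ + α₁)) ≤ 16 * d * L * B₁ * (α₀ + α₁) := by nlinarith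
  exact hwit_unitary_of_datum hL p.2.1 h68 h74 ha hb hLb

end Member

end Literature.MathematicalPhysics.QuantumFieldTheory.Balaban1983to89.B8Prop5WitnessOfDatum

end
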